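import Literature.MathematicalPhysics.QuantumLattice.FermionicTreeExpansionDetBound
import HarnessLib

/-!
# The determinant-bound tree estimate in FIELD-LINE form

Topic `Literature/MathematicalPhysics/QuantumLattice`; a refinement of `FermionicTreeExpansionDetBound.lean`.
There the Brydges–Battle–Federbush tree expansion of the truncated fermionic expectation
`𝓔ᵀ(W) = ursellOf (moment c G) W` (`FermionicTreeExpansion.lean`) was bounded, under a determinant bound
`δ` for the Gram-weighted minors of the propagator matrix `G`, in the closed form
`‖𝓔ᵀ(W)‖ ≤ Σ_T δ^{|F_W|} ∏_{ℓ ∈ T} (2 n² M_ℓ)` with a cluster-type line bound `‖G f f'‖ ≤ M_{{c f, c f'}}`: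
each tree line costs the MAXIMAL propagator of its type times the number `≤ 2n²` of field lines of the type.
For EXTENDED vertices (the effective potentials of a multiscale expansion, whose fields sit at independent
points) the propagators of the field lines of one cluster type are all different and must be SUMMED, not
maximised (Benfatto–Giuliani–Mastropietro 2006, (2.66)–(2.77); Gentile–Mastropietro 2001, §4).  This file
re-runs the recursion in that form:

* the field-line sum of a cluster line `ℓ` is `Σ_{(f, f') : {c f, c f'} = ℓ} ‖G f f'‖` (written out as a
  `Finset.filter` sum; `sum_sum_ite_norm_mul_le_fieldLineSum_mul` compares it with the restricted sums
  through an enumeration of the fields);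
* `norm_eval_aeval_assignSum_le_fieldLineSum_of_detBound`, `norm_scriptTerm_le_fieldLineSum_of_detBound` —
  along the line extractions of a script,
  `‖(assignSum L I jm)(σ_s(t))‖ ≤ δ^{|F_W|} ∏_{ℓ ∈ L} Σ_{(f,f') of type ℓ} ‖G f f'‖`;
* `norm_ursellOf_moment_le_sum_lineSets_of_scriptBound` — the abstract passage from a bound on the script
  terms by a function of the LINE SET to the sum over the anchored cluster trees (the interpolation
  weights of the scripts traversing one tree add up to one, BGM 2006 Lemma 2.3);
* **`norm_ursellOf_moment_le_sum_lineSets_fieldLineSum_of_detBound`** —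
  `‖𝓔ᵀ(W)‖ ≤ Σ_{anchored cluster trees T on W} δ^{|F_W|} ∏_{ℓ ∈ T} Σ_{(f,f') of type ℓ} ‖G f f'‖`.

Everything is PROVED; no definition of physical content and no named fact.

## References
* G. Benfatto, A. Giuliani, V. Mastropietro, Ann. Henri Poincaré 7 (2006) 809–898, (2.66), (2.77), (2.80),
  Lemma 2.3. [cite: BenfattoGiulianiMastropietro2006, (2.66) (2.77) (2.80)]
* V. Mastropietro, *Non-Perturbative Renormalization* (2008), §2.9 (2.118)–(2.121). [cite: Mastropietro2008, §2.9]
* G. Gentile, V. Mastropietro, Phys. Rep. 352 (2001) 273–437, §4. [cite: GentileMastropietro2001, §4]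
-/

noncomputable section

open MvPolynomial Finsupp Matrix Finset Literature.RingTheory.MvPolynomial
open Literature.Probability.LatticeModels Literature.Probability.LatticeModels.BattleFederbush
open Literature.MeasureTheory.Integral Literature.Analysis.InnerProduct
open scoped InnerProductSpace

namespace Literature.MathematicalPhysics.QuantumLattice

namespace FermionicTree

variable {𝕜 : Type*} [RCLike 𝕜]
variable {ι : Type*} [DecidableEq ι] {F : Type*} [Fintype F] [LinearOrder F]
variable (c : F → ι) (G : Matrix F F 𝕜)

/-! ### The field-line sums of a cluster line -/

omit [LinearOrder F] in
/-- Through an injective enumeration of some fields, the restricted sum of `‖G‖ · X` over the field lines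
of a type is at most the field-line sum `Σ_{(f,f') of the type} ‖G f f'‖` times `X`. [folklore] -/
theorem sum_sum_ite_norm_mul_le_fieldLineSum_mul {r : ℕ} {e : Fin r → F} (he : Function.Injective e)
    (ℓ : Sym2 ι) (P : Fin r → Prop) [DecidablePred P] {X : ℝ} (hX : 0 ≤ X) :
    (∑ i : Fin r, ∑ j : Fin r, if P i ∧ s(c (e i), c (e j)) = ℓ then ‖G (e i) (e j)‖ * X else 0) ≤
      (∑ q ∈ univ.filter (fun q : F × F => s(c q.1, c q.2) = ℓ), ‖G q.1 q.2‖) * X := by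
  classical
  set h : F × F → ℝ := fun q => if s(c q.1, c q.2) = ℓ then ‖G q.1 q.2‖ * X else 0 with hh
  have hh0 : ∀ q, 0 ≤ h q := fun q => by
    simp only [hh]; split_ifs
    · exact mul_nonneg (norm_nonneg _) hX
    · exact le_rfl
  calc (∑ i : Fin r, ∑ j : Fin r, if P i ∧ s(c (e i), c (e j)) = ℓ then ‖G (e i) (e j)‖ * X else 0)
      ≤ ∑ i : Fin r, ∑ j : Fin r, h (e i, e j) := by
        refine sum_le_sum fun i _ => sum_le_sum fun j _ => ?_
        simp only [hh]
        split_ifs with h1 h2 h2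
        · exact le_rfl
        · exact absurd h1.2 h2
        · exact mul_nonneg (norm_nonneg _) hX
        · exact le_rfl
    _ = ∑ q : Fin r × Fin r, h (Prod.map e e q) := by rw [← Fintype.sum_prod_type']; rfl
    _ = ∑ q ∈ (univ : Finset (Fin r × Fin r)).image (Prod.map e e), h q := by
        rw [sum_image fun q _ q' _ hq => (he.prodMap he) hq]
    _ ≤ ∑ q : F × F, h q :=
        sum_le_univ_sum_of_nonneg hh0
    _ = (∑ q ∈ univ.filter (fun q : F × F => s(c q.1, c q.2) = ℓ), ‖G q.1 q.2‖) * X := by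
        rw [Finset.sum_mul, sum_filter]

/-! ### The recursive bound in field-line form -/

variable [Fintype ι] {v : ι} {k : ℕ}

omit [Fintype ι] in
/-- **Field-line form of the recursive determinant-bound estimate**: along the line extractions of a
valid script, `‖(assignSum L I jm)(σ_s(t))‖ ≤ δ^{|F_W|} ∏_{ℓ ∈ L} Σ_{(f,f') of type ℓ} ‖G f f'‖` for
`t ∈ [0,1]^ι` —
each extracted line costs the sum over the field lines of its type of `‖G‖`, and the last interpolated
determinant costs `δ^{|F_W|}` (`norm_eval_aeval_assignSum_le_of_detBound` with no line left).
[cite: BenfattoGiulianiMastropietro2006, (2.66) and (2.80)] -/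
theorem norm_eval_aeval_assignSum_le_fieldLineSum_of_detBound {δ : ℝ} (hδ : 1 ≤ δ)
    (hDB : ∀ (m r : ℕ) (w : Fin r → EuclideanSpace ℝ (Fin m)), (∀ a, ‖w a‖ = 1) →
      ∀ (e : Fin r ↪o F) (c' : ℕ) (ρ γ : Fin c' → Fin r), StrictMono ρ → StrictMono γ →
        ‖(Matrix.of fun a b : Fin c' =>
            ((⟪w (ρ a), w (γ b)⟫_ℝ : ℝ) : 𝕜) * G (e (ρ a)) (e (γ b))).det‖ ≤ δ ^ c')
    (s : Script v k) (hs : s.Valid) {t : ι → ℝ} (ht : t ∈ unitCube ι) :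
    ∀ (L : List (Sym2 ι)) (I : Finset F) (jm : F → F)
      (_ : ∀ a ∈ I, c a ∈ univ.image s.y ∧ c (jm a) ∈ univ.image s.y),
      ‖eval (fun i => (t i : 𝕜)) (aeval (s.decPt 𝕜)
        (assignSum c G (enum c (univ.image s.y)) L I jm))‖ ≤
        δ ^ (fieldsOf c (univ.image s.y)).card *
          (L.map fun ℓ => (∑ q ∈ univ.filter (fun q : F × F => s(c q.1, c q.2) = ℓ), ‖G q.1 q.2‖)).prod
  | [], I, jm, hI => by
    -- no line left: the closed bound of `FermionicTreeExpansionDetBound` with any admissible line bound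
    set Mtot : ℝ := ∑ q : F × F, ‖G q.1 q.2‖ with hMtot
    have hGM : ∀ f f', ‖G f f'‖ ≤ (fun _ : Sym2 ι => Mtot) s(c f, c f') := fun f f' =>
      single_le_sum (f := fun q : F × F => ‖G q.1 q.2‖) (fun q _ => norm_nonneg _) (mem_univ (f, f'))
    have hn : ∀ x : ι, (univ.filter fun f : F => c f = x).card ≤ Fintype.card F := fun x =>
      (card_filter_le _ _).trans (card_univ (α := F)).le
    have h := norm_eval_aeval_assignSum_le_of_detBound c G hδ hDB hn (fun _ => Mtot)
      (fun _ => sum_nonneg fun q _ => norm_nonneg _) hGM s hs ht [] I jm hI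
    simpa using h
  | ℓ :: L, I, jm, hI => by
    classical
    set Q := univ.image s.y with hQ
    set R : ℝ := δ ^ (fieldsOf c Q).card *
      (L.map fun ℓ => (∑ q ∈ univ.filter (fun q : F × F => s(c q.1, c q.2) = ℓ), ‖G q.1 q.2‖)).prod with hR
    have hR0 : 0 ≤ R := by
      refine mul_nonneg (by positivity) (List.prod_nonneg fun x hx => ?_)
      obtain ⟨ℓ', -, rfl⟩ := List.mem_map.1 hx
      exact sum_nonneg fun q _ => norm_nonneg _
    rw [assignSum, map_sum, map_sum]
    refine (norm_sum_le _ _).trans ?_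
    have hstep : ∀ i j : Fin (fieldsOf c Q).card,
        ‖eval (fun i => (t i : 𝕜)) (aeval (s.decPt 𝕜)
          (if enum c Q i ∉ I ∧ s(c (enum c Q i), c (enum c Q j)) = ℓ then
            C (G (enum c Q i) (enum c Q j)) *
              assignSum c G (enum c Q) L (insert (enum c Q i) I)
                (Function.update jm (enum c Q i) (enum c Q j))
          else 0))‖ ≤
        if enum c Q i ∉ I ∧ s(c (enum c Q i), c (enum c Q j)) = ℓ then
          ‖G (enum c Q i) (enum c Q j)‖ * R else 0 := by
      intro i j
      split_ifs with h
      · rw [map_mul, map_mul, aeval_C, MvPolynomial.algebraMap_eq, eval_C, norm_mul]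
        refine mul_le_mul_of_nonneg_left
          (norm_eval_aeval_assignSum_le_fieldLineSum_of_detBound hδ hDB s hs ht L _ _ fun a ha => ?_)
          (norm_nonneg _)
        have hℓ : ∀ x ∈ ℓ, x ∈ Q := by
          intro x hx
          rw [← h.2] at hx
          rcases Sym2.mem_iff.1 hx with rfl | rfl <;> exact c_enum_mem c Q _
        rcases mem_insert.1 ha with rfl | ha
        · rw [Function.update_self]
          exact ⟨hℓ _ (h.2 ▸ Sym2.mem_mk_left _ _), hℓ _ (h.2 ▸ Sym2.mem_mk_right _ _)⟩
        · have hne : a ≠ enum c Q i := fun h' => h.1 (h' ▸ ha)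
          rw [Function.update_of_ne hne]
          exact hI a ha
      · rw [map_zero, map_zero, norm_zero]
    calc ∑ i, ‖eval (fun i => (t i : 𝕜)) (aeval (s.decPt 𝕜) (∑ j,
          if enum c Q i ∉ I ∧ s(c (enum c Q i), c (enum c Q j)) = ℓ then
            C (G (enum c Q i) (enum c Q j)) *
              assignSum c G (enum c Q) L (insert (enum c Q i) I)
                (Function.update jm (enum c Q i) (enum c Q j))
          else 0))‖
        ≤ ∑ i, ∑ j, (if enum c Q i ∉ I ∧ s(c (enum c Q i), c (enum c Q j)) = ℓ then
            ‖G (enum c Q i) (enum c Q j)‖ * R else 0) := by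
          refine sum_le_sum fun i _ => ?_
          rw [map_sum, map_sum]
          exact (norm_sum_le _ _).trans (sum_le_sum fun j _ => hstep i j)
      _ ≤ (∑ q ∈ univ.filter (fun q : F × F => s(c q.1, c q.2) = ℓ), ‖G q.1 q.2‖) * R :=
          sum_sum_ite_norm_mul_le_fieldLineSum_mul c G (enum c Q).injective ℓ _ hR0
      _ = δ ^ (fieldsOf c Q).card *
            ((ℓ :: L).map fun ℓ => (∑ q ∈ univ.filter (fun q : F × F => s(c q.1, c q.2) = ℓ), ‖G q.1 q.2‖)).prod := by
          rw [List.map_cons, List.prod_cons, hR]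
          ring

/-- **Field-line form, one script**:
`‖scriptTerm s‖ ≤ δ^{|F_W|} ∏_{ℓ ∈ lines s} (Σ_{(f,f') of type ℓ} ‖G f f'‖) · ∫ w_s`. [folklore] -/
theorem norm_scriptTerm_le_fieldLineSum_of_detBound {δ : ℝ} (hδ : 1 ≤ δ)
    (hDB : ∀ (m r : ℕ) (w : Fin r → EuclideanSpace ℝ (Fin m)), (∀ a, ‖w a‖ = 1) →
      ∀ (e : Fin r ↪o F) (c' : ℕ) (ρ γ : Fin c' → Fin r), StrictMono ρ → StrictMono γ →
        ‖(Matrix.of fun a b : Fin c' =>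
            ((⟪w (ρ a), w (γ b)⟫_ℝ : ℝ) : 𝕜) * G (e (ρ a)) (e (γ b))).det‖ ≤ δ ^ c')
    (s : Script v k) (hs : s.Valid) :
    ‖scriptTerm c G v s‖ ≤
      δ ^ (fieldsOf c (univ.image s.y)).card *
        (s.lines.map fun ℓ => (∑ q ∈ univ.filter (fun q : F × F => s(c q.1, c q.2) = ℓ), ‖G q.1 q.2‖)).prod *
          cubeIntegral ι ℝ (s.weight ℝ) := by
  rw [scriptTerm, weight_eq_map]
  refine norm_cubeIntegral_map_mul_le _ _ (fun t ht => eval_weight_nonneg s ht) fun t ht => ?_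
  exact norm_eval_aeval_assignSum_le_fieldLineSum_of_detBound c G hδ hDB s hs ht s.lines ∅ id
    fun a ha => absurd ha (notMem_empty a)

/-- **From script bounds to tree bounds**: if the term of every valid script with point set `W` is
bounded by a function `B` of its LINE SET times its interpolation weight, then
`‖𝓔ᵀ(W)‖ ≤ Σ_{anchored cluster trees T on W} B(T)` — the weights of the scripts traversing the same tree
add up to one (`Script.sum_cubeIntegral_weight_eq_one`, Benfatto–Giuliani–Mastropietro 2006, Lemma 2.3).
[cite: BenfattoGiulianiMastropietro2006, (2.66) Lemma 2.3] -/
theorem norm_ursellOf_moment_le_sum_lineSets_of_scriptBound (W : Finset ι) (hv : v ∈ W)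
    (B : Finset (Sym2 ι) → ℝ)
    (hB : ∀ (k : ℕ) (s : Script v k), s.Valid → univ.image s.y = W →
      ‖scriptTerm c G v s‖ ≤ B s.lines.toFinset * cubeIntegral ι ℝ (s.weight ℝ)) :
    ‖ursellOf (moment c G) W‖ ≤ ∑ T ∈ lineSets v W, B T := by
  classical
  -- script form
  have h0 : ‖ursellOf (moment c G) W‖ ≤ ∑ k ∈ range (Fintype.card ι), ∑ s : Script v k,
      if s.Valid ∧ univ.image s.y = W then B s.lines.toFinset * cubeIntegral ι ℝ (s.weight ℝ) else 0 := by
    rw [ursellOf_moment_eq_treeSum c G W hv, treeSum]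
    refine (norm_sum_le _ _).trans (sum_le_sum fun k _ => (norm_sum_le _ _).trans (sum_le_sum fun s _ => ?_))
    split_ifs with h
    · exact hB k s h.1 h.2
    · rw [norm_zero]
  refine h0.trans (le_of_eq ?_)
  -- insert the tree of each script
  have h1 : ∀ (k : ℕ) (hk : k ∈ range (Fintype.card ι)) (s : Script v k),
      (if s.Valid ∧ univ.image s.y = W then B s.lines.toFinset * cubeIntegral ι ℝ (s.weight ℝ) else 0) =
      ∑ T ∈ lineSets v W, if s.Valid ∧ s.lines.toFinset = T then
        B T * cubeIntegral ι ℝ (s.weight ℝ) else 0 := by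
    intro k hk s
    by_cases hs : s.Valid
    · simp only [hs, true_and]
      rw [Finset.sum_ite_eq]
      by_cases hW : univ.image s.y = W
      · have hmem : s.lines.toFinset ∈ lineSets v W :=
          mem_lineSets.2 ⟨k, mem_range.1 hk, s, hs, hW, rfl⟩
        rw [if_pos hW, if_pos hmem]
      · rw [if_neg hW, if_neg]
        intro hmem
        obtain ⟨k', -, s', hs', hW', hT⟩ := mem_lineSets.1 hmem
        exact hW ((Script.image_y_eq_of_lines_eq s s' hT.symm).trans hW')
    · simp only [hs, false_and, if_false]
      exact (sum_const_zero).symm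
  rw [sum_congr rfl fun k hk => sum_congr rfl fun s _ => h1 k hk s]
  -- exchange the sums and use Lemma 2.3
  calc ∑ k ∈ range (Fintype.card ι), ∑ s : Script v k, ∑ T ∈ lineSets v W,
        (if s.Valid ∧ s.lines.toFinset = T then B T * cubeIntegral ι ℝ (s.weight ℝ) else 0)
      = ∑ T ∈ lineSets v W, ∑ k ∈ range (Fintype.card ι), ∑ s : Script v k,
          (if s.Valid ∧ s.lines.toFinset = T then B T * cubeIntegral ι ℝ (s.weight ℝ) else 0) := by
        rw [Finset.sum_comm]; exact sum_congr rfl fun k _ => Finset.sum_comm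
    _ = ∑ T ∈ lineSets v W, B T * ∑ k ∈ range (Fintype.card ι), ∑ s : Script v k,
          (if s.Valid ∧ s.lines.toFinset = T then cubeIntegral ι ℝ (s.weight ℝ) else 0) := by
        refine sum_congr rfl fun T _ => ?_
        rw [Finset.mul_sum]
        refine sum_congr rfl fun k _ => ?_
        rw [Finset.mul_sum]
        refine sum_congr rfl fun s _ => ?_
        rw [mul_ite, mul_zero]
    _ = ∑ T ∈ lineSets v W, B T := by
        refine sum_congr rfl fun T hT => ?_
        obtain ⟨k₀, -, s₀, hs₀, -, rfl⟩ := mem_lineSets.1 hT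
        rw [Script.sum_cubeIntegral_weight_eq_one s₀ hs₀, mul_one]

/-- **The determinant-bound tree estimate in FIELD-LINE form** (Benfatto–Giuliani–Mastropietro 2006,
(2.66)/(2.77) with (2.80)): if every Gram-weighted minor of the propagator matrix `G` has
`‖det‖ ≤ δ^{size}` (`δ ≥ 1`), then
`‖𝓔ᵀ(W)‖ ≤ Σ_{anchored cluster trees T on W} δ^{|F_W|} ∏_{ℓ ∈ T} Σ_{(f,f') of type ℓ} ‖G f f'‖`.
Compared with `norm_ursellOf_moment_le_sum_lineSets_of_detBound` the factor of a tree line is the SUM of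
the propagator bounds over its field lines instead of `2n²` times their maximum — the form that sums the
positions of the fields of extended vertices. [cite: BenfattoGiulianiMastropietro2006, (2.66) (2.77) (2.80)] -/
theorem norm_ursellOf_moment_le_sum_lineSets_fieldLineSum_of_detBound {δ : ℝ} (hδ : 1 ≤ δ)
    (hDB : ∀ (m r : ℕ) (w : Fin r → EuclideanSpace ℝ (Fin m)), (∀ a, ‖w a‖ = 1) →
      ∀ (e : Fin r ↪o F) (c' : ℕ) (ρ γ : Fin c' → Fin r), StrictMono ρ → StrictMono γ →
        ‖(Matrix.of fun a b : Fin c' =>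
            ((⟪w (ρ a), w (γ b)⟫_ℝ : ℝ) : 𝕜) * G (e (ρ a)) (e (γ b))).det‖ ≤ δ ^ c')
    (W : Finset ι) (hv : v ∈ W) :
    ‖ursellOf (moment c G) W‖ ≤
      ∑ T ∈ lineSets v W, δ ^ (fieldsOf c W).card *
        ∏ ℓ ∈ T, (∑ q ∈ univ.filter (fun q : F × F => s(c q.1, c q.2) = ℓ), ‖G q.1 q.2‖) := by
  refine norm_ursellOf_moment_le_sum_lineSets_of_scriptBound c G W hv
    (fun T => δ ^ (fieldsOf c W).card *
      ∏ ℓ ∈ T, (∑ q ∈ univ.filter (fun q : F × F => s(c q.1, c q.2) = ℓ), ‖G q.1 q.2‖)) fun k s hs hW => ?_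
  refine (norm_scriptTerm_le_fieldLineSum_of_detBound c G hδ hDB s hs).trans (le_of_eq ?_)
  rw [← hW, List.prod_toFinset _ (Script.nodup_lines s hs)]

end FermionicTree

end Literature.MathematicalPhysics.QuantumLattice
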